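import Literature.MathematicalPhysics.QuantumManyBody.BoseGasThermodynamicLimitRuelle
import HarnessLib

/-!
# Route `BECCutLineWeakDisorder`, crux `GroundStateRigidity` (stmt-AtomisticToContinuum-9072),
# line `Sketch`: the registered stub `stub_finiteEnergyLowDensity`

Supports (does not close) stmt-AtomisticToContinuum-9072. **Finite ground-state energy at low
density (every admissible `v`).** For a repulsive finite-range pair potential `v` there is
`ρ₁ > 0` such that for every density `0 < ρ < ρ₁` the Dirichlet ground-state energy
`E₀(N, L_N)` in the box of side `L_N = (N/ρ)^{1/3}` is finite for all large `N` (hard cores fit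
at low density; needed because `E₀ = ⊤` kills rigidity).

## Proof

With `R > 0` a range of `v` (`IsRepulsiveFiniteRange.exists_pos_range`) take
`ρ₁ = 1/(2(1+R)³)`; then `ρ(1+R)³ < 1` for `ρ < ρ₁`, so Ruelle's subcritical bound
(`limsup_lt_top_of_small`, [Ruelle1969, §3.5.11]: one particle per unit cell fits) gives
`limsup_N E₀(N, L_N)/N < ∞`, hence eventually `E₀(N, L_N)/N < ∞`
(`Filter.eventually_lt_of_limsup_lt`), and `E₀(N, L_N) = ∞` would force `E₀(N, L_N)/N = ∞`
(`ENNReal.top_div_of_ne_top`, as `(N : ℝ≥0∞) ≠ ∞`).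
-/

noncomputable section

open MeasureTheory Filter
open scoped ENNReal NNReal Topology

namespace Summit.AtomisticToContinuum.BoseEinsteinCondensation.Theorems.GroundStateRigidity

open Literature.MathematicalPhysics.QuantumManyBody.BoseGas

/-- If the energy per particle `E / N` is finite in `ℝ≥0∞` (with `N` a natural number, so that
`(N : ℝ≥0∞) ≠ ⊤`), then the energy `E` itself is finite. [folklore] -/
theorem ne_top_of_div_natCast_lt_top {E : ℝ≥0∞} {N : ℕ} (h : E / N < ⊤) : E ≠ ⊤ := by
  intro htop
  rw [htop, ENNReal.top_div_of_ne_top (ENNReal.natCast_ne_top N)] at h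
  exact lt_irrefl _ h

/-- **Stub 5a — finite ground-state energy at low density (every admissible `v`).** For a
repulsive finite-range `v` there is `ρ₁ > 0` such that for `0 < ρ < ρ₁` and all large `N` the
Dirichlet ground-state energy in the box of side `(N/ρ)^{1/3}` is finite: with `R > 0` a range of
`v`, `ρ₁ = 1/(2(1+R)³)` works, by Ruelle's superadditivity bound `limsup_lt_top_of_small`
(`limsup_N E₀(N, L_N)/N < ⊤` once `ρ(1+R)³ < 1`) and
`energyPerParticleDirichlet v ρ N = E₀(N, sideLength ρ N)/N`. [cite: Ruelle1969, §3.5.11] -/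
theorem stub_finiteEnergyLowDensity :
    ∀ v : ℝ → ℝ≥0∞, IsRepulsiveFiniteRange v →
      ∃ ρ₁ : ℝ, 0 < ρ₁ ∧ ∀ ρ : ℝ, 0 < ρ → ρ < ρ₁ → ∀ᶠ N : ℕ in atTop,
        groundStateEnergy v N (sideLength ρ N) ≠ ⊤ := by
  intro v hv
  obtain ⟨R, hR, hv0⟩ := hv.exists_pos_range
  have h3 : (0 : ℝ) < (1 + R) ^ 3 := by positivity
  refine ⟨1 / (2 * (1 + R) ^ 3), by positivity, fun ρ hρ hρlt => ?_⟩
  have hsmall : ρ * (1 + R) ^ 3 < 1 := by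
    calc ρ * (1 + R) ^ 3 < 1 / (2 * (1 + R) ^ 3) * (1 + R) ^ 3 :=
          mul_lt_mul_of_pos_right hρlt h3
      _ = 1 / 2 := by field_simp
      _ < 1 := by norm_num
  have hlim : limsup (energyPerParticleDirichlet v ρ) atTop < ⊤ :=
    limsup_lt_top_of_small hv.1 hv0 hR hρ hsmall
  have hev : ∀ᶠ N : ℕ in atTop, energyPerParticleDirichlet v ρ N < ⊤ :=
    Filter.eventually_lt_of_limsup_lt hlim
  filter_upwards [hev] with N hN
  exact ne_top_of_div_natCast_lt_top hN

end Summit.AtomisticToContinuum.BoseEinsteinCondensation.Theorems.GroundStateRigidity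

end
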